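import Literature.MathematicalPhysics.QuantumFieldTheory.QCDNontrivialityScheme
import Summits.QuantumFields.QCD.Theorems.SpectralDefectExtinctionChiralDescentStubChiralPointOfBodyEverywhere

/-!
# Line `gap-upset-recut` for `ChiralDescent` (crux stmt-QuantumFields-17527) — stub W_lim `stub_wallLimitNoGo`:
# the `IsQCDAlong` clause is CONSISTENT at the wall at every real tuple, and W_lim is exactly short of
# supercritical decoupling (worker of lead c12; `--supports`, the stub itself is NOT claimed)

The registered stub W_lim (`stub_wallLimitNoGo` of `Cruxes/ChiralDescent/Lines/gap_upset_recut.lean`) says: for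
`N_f ∈ {2,3}` and a mass-scaling regularisation `reg` with `m_crit(k) → −1` (every fixed renormalised tuple runs all its
bare Wilson masses `→ −1⁺`, hopping parameter `→ 1/6⁻`), NO offset `μ` carries the body (`IsQCDAlong` + non-trivial
non-Gaussian glue + non-trivial flavour-changing pseudoscalars + OS gap + lattice gap) at every tuple above `μ`.

Two kernel-checked facts sizing W_lim:

* `exists_wallLimit_isQCDAlong_vacuum_everywhere` — **the cheap angles are EMPTY.**  There is a mass-scaling
  regularisation with `m_crit(k) → −1` (the canonical one re-pinned at `m_crit(k) = −1 + a_k`, margin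
  `(m_crit + 1) Z_m / a = Z_m → ∞`) along which, at EVERY real tuple `m` and every additive counterterm, the clause
  `IsQCDAlong (reg.scheme m 0 shift) T` is INHABITED (by the vacuum: with `z ≡ 0` all lattice functions vanish).  So
  asymptotic scaling, the physical-branch clause and the convergence clause, together with `HasMassScaling` and the
  wall limit, are jointly consistent at all tuples at once: W_lim has NO data-level / `IsQCDAlong`-level content, and
  (`not_isNontrivial_wallLimit_vacuum_witness`) this witness is trivial in every field, so it does not refute W_lim
  either.  The whole content of W_lim is in the honest lattice expectations behind `IsNontrivial`,
  `IsNonGaussian`, `HasMassGap`, `HasLatticeMassGap`.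
* `stub_wallLimitNoGo_of_wallDecoupling` — **W_lim ⇐ SUPERCRITICAL DECOUPLING**, the missing physical statement typed
  exactly: along a wall-limit mass-scaling regularisation every OS limit `T` with `IsQCDAlong (reg.scheme m z shift) T`
  has TRIVIAL flavour-changing pseudoscalars, `¬ T.IsNontrivial (pseudoRe f g)` for `f ≠ g` (quarks whose bare Wilson
  mass tends to `−1` sit at the cutoff scale — free dispersion `E = |log(1 + M)| → ∞` at `M → −1`, doublers at
  `log 2, log 4, log 6` — and drop out of every correlation at fixed physical separation; non-perturbatively this is
  control of the supercritical Wilson–Dirac inverse in rough gauge fields, mobility-edge grade, and NO theorem or named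
  fact of the tree supplies it: the hopping-expansion barriers `HoppingExpansionLocality`/`HoppingExpansionUniformGap`
  stop at `κ < 1/8`, `QCDHeavyQuarkPropagator` at bare mass `≥ m₀ > 0`).  Given it, W_lim is read off at the tuple
  `(μ + 1, …, μ + 1)` and the flavours `0 ≠ 1`.

Pure bookkeeping over `QCDOS.lean`, `QCDNontrivialityScheme.lean` and the landed
`…StubChiralPointOfBodyEverywhere` (`forall_eventually_branch_iff_tendsto_mcritMargin`); standard axioms; no physics
is proved here.
-/

namespace Summit.QuantumFields.QCD.Cruxes.ChiralDescent.GapUpsetRecut.WallLimitNoGo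

open Filter Topology
open Literature.MathematicalPhysics.QuantumFieldTheory Literature.MathematicalPhysics.AQFT
open Summit.QuantumFields.QCD.Theorems.RobustYangMillsHandover.Negative (tendsto_Zm_atTop)

variable {Nf : ℕ}

/-! ## §1 The `IsQCDAlong` clause is consistent at the wall, at every real tuple at once -/

/-- **Along a scheme with `z ≡ 0` the vacuum is QCD as soon as the two scheme-side clauses hold**: asymptotic scaling
and the physical branch are hypotheses, and every lattice `n`-point function (`n ≥ 1`) vanishes
(`qcdLatticeSchwinger_eq_zero_of_z`), as does every Schwinger function of the vacuum. [folklore] -/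
theorem isQCDAlong_vacuum_of_schemeSide (sch : QCDScheme Nf) (hz : sch.z = 0) (hAS : sch.HasAsymptoticScaling)
    (hbr : ∀ fl : Fin Nf, ∀ᶠ k in atTop, -1 < sch.mq fl k) :
    IsQCDAlong sch (OSData.vacuum (QCDField Nf) 4) := by
  refine ⟨hAS, hbr, fun n hn σ f F _ _ => ?_⟩
  have hS : (OSData.vacuum (QCDField Nf) 4).schwinger n σ F = 0 := by
    simp [OSData.vacuum, LabelledSchwingerFamily.trivial_of_ne_zero (QCDField Nf) hn]
  rw [hS]
  exact tendsto_const_nhds.congr' (Eventually.of_forall fun k =>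
    (qcdLatticeSchwinger_eq_zero_of_z sch hz k n hn σ f).symm)

/-- **THE CHEAP ANGLES ON W_lim ARE EMPTY (sharpness of the data-level clauses at the wall).**  For `0 < N_f ≤ 16`
there is a MASS-SCALING regularisation whose critical masses CONVERGE TO THE WALL, `m_crit(k) → −1`, along which the
clause `IsQCDAlong (reg.scheme m 0 shift) T` is inhabited at EVERY real tuple `m` and every additive counterterm
`shift` (by the vacuum).  Witness: `canonicalAF` re-pinned at `m_crit(k) = −1 + a_k`; its margin
`(m_crit(k) + 1) Z_m(k) / a_k = Z_m(k) → ∞` gives the branch clause at every real tuple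
(`forall_eventually_branch_iff_tendsto_mcritMargin`), its couplings scale asymptotically with `Λ = 1`, and with
`z ≡ 0` the lattice functions vanish.  Hence `HasMassScaling ∧ m_crit → −1 ∧ (∀ m, ∃ z shift T, IsQCDAlong …)` is
consistent: no contradiction can be drawn for W_lim from asymptotic scaling, the branch clause or the convergence
clause — its content is entirely in the physical clauses (non-triviality, non-Gaussianity, the two gaps). [folklore] -/
theorem exists_wallLimit_isQCDAlong_vacuum_everywhere (hNf0 : 0 < Nf) (hNf16 : Nf ≤ 16) :
    ∃ reg : QCDRegularisation Nf, reg.HasMassScaling ∧ Tendsto reg.mcrit atTop (𝓝 (-1)) ∧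
      ∀ (m : Fin Nf → ℝ) (shift : QCDField Nf → ℕ → ℝ),
        IsQCDAlong (reg.scheme m 0 shift) (OSData.vacuum (QCDField Nf) 4) := by
  refine ⟨{ QCDRegularisation.canonicalAF Nf with mcrit := fun k => -1 + (QCDRegularisation.canonicalAF Nf).a k },
    QCDRegularisation.canonicalAF_hasMassScaling, ?_, fun m shift => ?_⟩
  · have ha : Tendsto (fun k => -1 + (QCDRegularisation.canonicalAF Nf).a k) atTop (𝓝 (-1 + 0)) :=
      tendsto_const_nhds.add (QCDRegularisation.canonicalAF Nf).tendsto_a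
    rw [add_zero] at ha
    exact ha
  · have hmargin : Tendsto (fun k =>
        (({ QCDRegularisation.canonicalAF Nf with
            mcrit := fun k => -1 + (QCDRegularisation.canonicalAF Nf).a k } : QCDRegularisation Nf).mcrit k + 1) *
          ({ QCDRegularisation.canonicalAF Nf with
            mcrit := fun k => -1 + (QCDRegularisation.canonicalAF Nf).a k } : QCDRegularisation Nf).Zm k /
          ({ QCDRegularisation.canonicalAF Nf with
            mcrit := fun k => -1 + (QCDRegularisation.canonicalAF Nf).a k } : QCDRegularisation Nf).a k)
        atTop atTop := by
      have hZ := tendsto_Zm_atTop hNf16 (QCDRegularisation.canonicalAF Nf) QCDRegularisation.canonicalAF_hasMassScaling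
      refine hZ.congr fun k => ?_
      have ha : (QCDRegularisation.canonicalAF Nf).a k ≠ 0 := ((QCDRegularisation.canonicalAF Nf).a_pos k).ne'
      change (QCDRegularisation.canonicalAF Nf).Zm k =
        (-1 + (QCDRegularisation.canonicalAF Nf).a k + 1) * (QCDRegularisation.canonicalAF Nf).Zm k /
          (QCDRegularisation.canonicalAF Nf).a k
      field_simp
      ring
    refine isQCDAlong_vacuum_of_schemeSide _ rfl ⟨1, one_pos, ?_⟩ fun fl => ?_
    · simp [QCDRegularisation.scheme, QCDRegularisation.canonicalAF, QCDScheme.zeroAF]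
    · have h := (forall_eventually_branch_iff_tendsto_mcritMargin hNf0 _).2 hmargin m fl
      simpa only [QCDRegularisation.scheme_mq] using h

/-- **… and the witness does not refute W_lim**: whatever OS data are QCD along a scheme with `z ≡ 0` are trivial in
EVERY field (`not_isNontrivial_of_isQCDAlong_scheme_zero`), in particular in the flavour-changing pseudoscalars, so the
body fails at every tuple of the sharpness witness — consistently with W_lim. [folklore] -/
theorem not_isNontrivial_wallLimit_vacuum_witness (reg : QCDRegularisation Nf) (m : Fin Nf → ℝ)
    (shift : QCDField Nf → ℕ → ℝ) {T : OSData (QCDField Nf) 4} (hT : IsQCDAlong (reg.scheme m 0 shift) T)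
    (f g : Fin Nf) : ¬ T.IsNontrivial (QCDField.pseudoRe f g) :=
  not_isNontrivial_of_isQCDAlong_scheme_zero reg m shift hT _

/-! ## §2 W_lim from supercritical decoupling -/

/-- **W_lim ⇐ SUPERCRITICAL DECOUPLING OF THE FLAVOUR-CHANGING PSEUDOSCALARS (registered sub-goal
`stub_wallLimitNoGo_of_wallDecoupling` of stmt-QuantumFields-17527).**  Hypothesis `hD` (the missing physical fact,
typed exactly; open — localisation of the supercritical near-zero modes of `D_W` at bare mass `→ −1`, no theorem or
named fact of the tree): for `N_f ∈ {2,3}`, along a mass-scaling regularisation with `m_crit(k) → −1`, every OS datum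
that is QCD along `reg.scheme m z shift` (any tuple, any species renormalisations) has trivial flavour-changing
pseudoscalar two-point functions.  Conclusion: VERBATIM the registered `stub_wallLimitNoGo` — at the tuple
`(μ + 1, …, μ + 1)` the body would give `IsQCDAlong` data non-trivial in `pseudoRe 0 1`, which `hD` denies. [folklore] -/
theorem stub_wallLimitNoGo_of_wallDecoupling : (∀ Nf : ℕ, (Nf = 2 ∨ Nf = 3) → ∀ reg : QCDRegularisation Nf, reg.HasMassScaling → Tendsto reg.mcrit atTop (nhds (-1)) → ∀ (m : Fin Nf → ℝ) (z shift : QCDField Nf → ℕ → ℝ) (T : OSData (QCDField Nf) 4), IsQCDAlong (reg.scheme m z shift) T → ∀ f g : Fin Nf, f ≠ g → ¬ T.IsNontrivial (QCDField.pseudoRe f g)) → ∀ Nf : ℕ, (Nf = 2 ∨ Nf = 3) → ∀ reg : QCDRegularisation Nf, reg.HasMassScaling → Tendsto reg.mcrit atTop (nhds (-1)) → ∀ μ : ℝ, ¬ ∀ m : Fin Nf → ℝ, (∀ f, μ < m f) → ∃ (z shift : QCDField Nf → ℕ → ℝ) (T : OSData (QCDField Nf) 4), IsQCDAlong (reg.scheme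 m z shift) T ∧ T.IsNontrivial QCDField.glue ∧ T.IsNonGaussian QCDField.glue ∧ (∀ f g : Fin Nf, f ≠ g → T.IsNontrivial (QCDField.pseudoRe f g)) ∧ ∃ Δ > 0, T.HasMassGap Δ ∧ (reg.scheme m z shift).HasLatticeMassGap Δ := by
  intro hD Nf hNf reg hMS hwall μ hbody
  have h2 : 2 ≤ Nf := by rcases hNf with rfl | rfl <;> norm_num
  obtain ⟨z, shift, T, hQ, -, -, hP, -⟩ := hbody (fun _ => μ + 1) fun _ => by linarith
  have hne : (⟨0, by omega⟩ : Fin Nf) ≠ ⟨1, by omega⟩ := by simp [Fin.ext_iff]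
  exact hD Nf hNf reg hMS hwall _ z shift T hQ _ _ hne (hP _ _ hne)

/-- **The single-tuple form suffices too** (how a decoupling theorem at ONE trajectory would be consumed): if along
every wall-limit mass-scaling regularisation (`N_f ∈ {2,3}`) NO tuple carries the body, then W_lim. [folklore] -/
theorem stub_wallLimitNoGo_of_pointwise
    (hpt : ∀ Nf : ℕ, (Nf = 2 ∨ Nf = 3) → ∀ reg : QCDRegularisation Nf, reg.HasMassScaling →
      Tendsto reg.mcrit atTop (nhds (-1)) → ∀ m : Fin Nf → ℝ,
      ¬ ∃ (z shift : QCDField Nf → ℕ → ℝ) (T : OSData (QCDField Nf) 4),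
        IsQCDAlong (reg.scheme m z shift) T ∧ T.IsNontrivial QCDField.glue ∧ T.IsNonGaussian QCDField.glue ∧
          (∀ f g : Fin Nf, f ≠ g → T.IsNontrivial (QCDField.pseudoRe f g)) ∧
            ∃ Δ > 0, T.HasMassGap Δ ∧ (reg.scheme m z shift).HasLatticeMassGap Δ) :
    ∀ Nf : ℕ, (Nf = 2 ∨ Nf = 3) → ∀ reg : QCDRegularisation Nf, reg.HasMassScaling →
    Tendsto reg.mcrit atTop (nhds (-1)) → ∀ μ : ℝ,
    ¬ ∀ m : Fin Nf → ℝ, (∀ f, μ < m f) →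
      ∃ (z shift : QCDField Nf → ℕ → ℝ) (T : OSData (QCDField Nf) 4),
        IsQCDAlong (reg.scheme m z shift) T ∧ T.IsNontrivial QCDField.glue ∧ T.IsNonGaussian QCDField.glue ∧
          (∀ f g : Fin Nf, f ≠ g → T.IsNontrivial (QCDField.pseudoRe f g)) ∧
            ∃ Δ > 0, T.HasMassGap Δ ∧ (reg.scheme m z shift).HasLatticeMassGap Δ :=
  fun Nf hNf reg hMS hwall μ hbody => hpt Nf hNf reg hMS hwall (fun _ => μ + 1) (hbody _ fun _ => by linarith)

end Summit.QuantumFields.QCD.Cruxes.ChiralDescent.GapUpsetRecut.WallLimitNoGo
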